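import Summits.AtomisticToContinuum.HydrodynamicLimit.Theorems.EnskogAdjointDualityAdjointEnskogTestFamilyRSpatialTransfer
import Summits.AtomisticToContinuum.HydrodynamicLimit.Theorems.EnskogAdjointDualityAdjointEnskogTestFamilyRTransferBoundLipschitz
import Summits.AtomisticToContinuum.HydrodynamicLimit.Theorems.EnskogAdjointDualityAdjointEnskogTestFamilyRMaxwellianFluxCalculus
import Literature.Analysis.FluidPDE.BoltzmannEquationProofs
import HarnessLib

/-!
# K2R transfer bound III: spatial finite differences and angular averages of the reduced integrand

Route `EnskogAdjointDuality` of `AtomisticToContinuum/HydrodynamicLimit`, crux `AdjointEnskogTestFamilyR`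
(stmt-AtomisticToContinuum-11592, "K2R"), line `birth`, stub `stub_transferBound` (G3b), helper III.

After the pointwise replacement (helper II) the position × direction transfer integrand is
`F₀(ω, x) = −W(x) (β(x)−β(x+εω))·ω − W(x) (u(x)·ω) (γ(x)−γ(x+εω))` with the SMOOTH weight
`W = Yρ²θ` and merely continuous coefficients `β, γ`.  This file evaluates `∫_{S²}∫_{𝕋³} F₀` to order `ε²`:

* `k2r_tb_spatial` — per direction `ω`, componentwise application of stub B3b (i)
  (`k2r_abs_integral_mul_sub_translate_sub_le`): `|∫ F₀(ω,·) + ε B(ω)| ≤ 6 K₂ C ε²` with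
  `B(ω) = ∫ [(ω·∇W)(β·ω) + (∑ⱼ ωⱼ ω·∇(W uⱼ)) γ] dx`;
* `k2r_tb_sphere_avg_inner`, `k2r_tb_sphere_avg_sum` — the angular averages `∫ (ω·a)(b·ω) dσ = (4π/3) b·a`,
  `∫ ∑ⱼ ωⱼ (ω·aⱼ) dσ = (4π/3) ∑ⱼ (aⱼ)ⱼ` (stub B3b (ii));
* `k2r_tb_angular` — Fubini and the angular averages: `∫_{S²} B dσ = (4π/3) ∫ (β·∇W + γ div(W u)) dx`
  (registered sub-goal `stub_transferBound_angular`), together with the integrability of the integrand of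
  `B` on `S² × 𝕋³` (`k2r_tb_integrable_b`; continuous functions on compact spaces of finite measure).

References: C. Cercignani, R. Illner, M. Pulvirenti, *The Mathematical Theory of Dilute Gases* (1994),
§3.1 [CIP1994].
-/

noncomputable section

open MeasureTheory Metric Set Filter Topology Function
open scoped InnerProductSpace BigOperators

namespace Summit.AtomisticToContinuum.HydrodynamicLimit.Theorems.EnskogAdjointDuality

open Literature.Analysis.FluidPDE Literature.MathematicalPhysics.KineticTheory Literature.Analysis.FunctionSpaces

/-! ## Coordinate expansions -/

/-- `⟪a, ω⟫ = ∑ᵢ ωᵢ aᵢ` on `ℝ³`. [folklore] -/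
theorem k2r_tb_inner_eq_sum (a ω : V3) : ⟪a, ω⟫_ℝ = ∑ i, ω i * a i := by
  simp [PiLp.inner_apply]

/-- `ωⱼ = ⟪eⱼ, ω⟫`. [folklore] -/
theorem k2r_tb_apply_eq_inner_single (ω : V3) (j : Fin 3) :
    ω j = ⟪EuclideanSpace.single j (1 : ℝ), ω⟫_ℝ := by
  simp [EuclideanSpace.inner_single_left]

/-- Continuous functions on `S² × 𝕋³` are integrable for `σ ⊗ vol`. [folklore] -/
theorem k2r_tb_integrable_sphere_torus {f : sphere (0 : V3) 1 × T3 → ℝ} (hf : Continuous f) :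
    Integrable f ((sphereMeasure : Measure (sphere (0 : V3) 1)).prod volume) := by
  haveI := isFiniteMeasure_sphereMeasure (E := V3)
  exact hf.integrable_of_hasCompactSupport (HasCompactSupport.of_compactSpace f)

/-! ## Spatial finite differences, componentwise -/

/-- **Finite differences of the coefficients against the smooth weight, per direction.** For `W` smooth
with `∇W` `K₂`-Lipschitz, `W uⱼ` smooth with `∇(W uⱼ)` `K₂`-Lipschitz (`j = 1,2,3`), continuous
coefficients `‖β‖ ≤ C`, `|γ| ≤ C`, a unit vector `ω` and `ε ∈ ℝ`, with `y = x + εω`: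
`|∫ (−W(x)(β(x)−β(y))·ω − W(x)(u(x)·ω)(γ(x)−γ(y))) dx + ε ∫ ((ω·∇W)(β·ω) + (∑ⱼ ωⱼ ω·∇(Wuⱼ)) γ) dx| ≤ 6 K₂ C ε²`
(stub B3b (i) for each of the six scalar coefficients `βᵢ`, `γ` against the weights `W`, `W uⱼ`).
[cite: CIP1994, §3.1] -/
theorem k2r_tb_spatial {W : T3 → ℝ} {u : T3 → V3} (hW : Torus.IsSmooth W)
    (hWu : ∀ j : Fin 3, Torus.IsSmooth (fun y => W y * u y j)) {K₂ : ℝ}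
    (hK : ∀ x x', ‖Torus.gradient W x - Torus.gradient W x'‖ ≤ K₂ * dist x x')
    (hKu : ∀ (j : Fin 3) x x', ‖Torus.gradient (fun y => W y * u y j) x -
      Torus.gradient (fun y => W y * u y j) x'‖ ≤ K₂ * dist x x')
    {β : T3 → V3} {γ : T3 → ℝ} (hβ : Continuous β) (hγ : Continuous γ) {C : ℝ}
    (hβC : ∀ x, ‖β x‖ ≤ C) (hγC : ∀ x, |γ x| ≤ C) (ε : ℝ) (ω : sphere (0 : V3) 1) :
    |(∫ x : T3, (-(W x * ⟪β x - β ((Torus.geometry (Fin 3)).translate x (ε • (ω : V3))), (ω : V3)⟫_ℝ) -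
        W x * ⟪u x, (ω : V3)⟫_ℝ * (γ x - γ ((Torus.geometry (Fin 3)).translate x (ε • (ω : V3)))))) +
      ε * ∫ x : T3, (⟪(ω : V3), Torus.gradient W x⟫_ℝ * ⟪β x, (ω : V3)⟫_ℝ +
        (∑ j, (ω : V3) j * ⟪(ω : V3), Torus.gradient (fun y => W y * u y j) x⟫_ℝ) * γ x)| ≤
      6 * K₂ * C * ε ^ 2 := by
  set a : V3 := (ω : V3) with ha
  have ha1 : ‖a‖ ≤ 1 := (norm_eq_of_mem_sphere ω).le
  set τ : T3 → T3 := fun x => (Torus.geometry (Fin 3)).translate x (ε • a) with hτ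
  have hτc : Continuous τ := by
    simp only [hτ, Torus.geometry_translate]; fun_prop
  have hWc : Continuous W := hW.continuous
  have hGc : Continuous (Torus.gradient W) := hW.gradient.continuous
  have hWuc : ∀ j, Continuous (fun y => W y * u y j) := fun j => (hWu j).continuous
  have hGuc : ∀ j, Continuous (Torus.gradient (fun y => W y * u y j)) :=
    fun j => (hWu j).gradient.continuous
  have hβi : ∀ i, Continuous fun x => β x i := fun i => by fun_prop
  have hβiC : ∀ i x, |β x i| ≤ C := fun i x =>
    (by simpa using PiLp.norm_apply_le (β x) i : |β x i| ≤ ‖β x‖).trans (hβC x)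
  -- (1) the `β`-part, component by component
  set X : Fin 3 → ℝ := fun i => ∫ x : T3, W x * (β x i - β (τ x) i) with hX
  set Z : Fin 3 → ℝ := fun i => ∫ x : T3, ⟪a, Torus.gradient W x⟫_ℝ * β x i with hZ
  have hXZ : ∀ i, |X i - ε * Z i| ≤ K₂ * C * ε ^ 2 := fun i =>
    k2r_abs_integral_mul_sub_translate_sub_le W hW K₂ hK (fun x => β x i) (hβi i) C (hβiC i) ε a ha1
  have h1 : ∫ x : T3, W x * ⟪β x - β (τ x), a⟫_ℝ = ∑ i, a i * X i := by
    have hI : ∀ i, Integrable (fun x : T3 => a i * (W x * (β x i - β (τ x) i))) := fun i =>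
      (continuous_const.mul (hWc.mul ((hβi i).sub ((hβi i).comp hτc)))).integrable_unitAddTorus
    simp_rw [hX, ← integral_const_mul]
    rw [← integral_finsetSum _ fun i _ => hI i]
    refine integral_congr_ae (Eventually.of_forall fun x => ?_)
    simp only [k2r_tb_inner_eq_sum, PiLp.sub_apply, Finset.mul_sum]
    refine Finset.sum_congr rfl fun i _ => ?_
    ring
  have h2 : ∫ x : T3, ⟪a, Torus.gradient W x⟫_ℝ * ⟪β x, a⟫_ℝ = ∑ i, a i * Z i := by
    have hI : ∀ i, Integrable (fun x : T3 => a i * (⟪a, Torus.gradient W x⟫_ℝ * β x i)) := fun i =>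
      (continuous_const.mul ((continuous_const.inner hGc).mul (hβi i))).integrable_unitAddTorus
    simp_rw [hZ, ← integral_const_mul]
    rw [← integral_finsetSum _ fun i _ => hI i]
    refine integral_congr_ae (Eventually.of_forall fun x => ?_)
    simp only [k2r_tb_inner_eq_sum (β x), Finset.mul_sum]
    refine Finset.sum_congr rfl fun i _ => ?_
    ring
  -- (2) the `γ`-part, weight by weight
  set X' : Fin 3 → ℝ := fun j => ∫ x : T3, (W x * u x j) * (γ x - γ (τ x)) with hX'
  set Z' : Fin 3 → ℝ := fun j => ∫ x : T3, ⟪a, Torus.gradient (fun y => W y * u y j) x⟫_ℝ * γ x with hZ'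
  have hXZ' : ∀ j, |X' j - ε * Z' j| ≤ K₂ * C * ε ^ 2 := fun j =>
    k2r_abs_integral_mul_sub_translate_sub_le (fun y => W y * u y j) (hWu j) K₂ (hKu j) γ hγ C hγC ε a ha1
  have h3 : ∫ x : T3, W x * ⟪u x, a⟫_ℝ * (γ x - γ (τ x)) = ∑ j, a j * X' j := by
    have hI : ∀ j, Integrable (fun x : T3 => a j * ((W x * u x j) * (γ x - γ (τ x)))) := fun j =>
      (continuous_const.mul ((hWuc j).mul (hγ.sub (hγ.comp hτc)))).integrable_unitAddTorus
    simp_rw [hX', ← integral_const_mul]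
    rw [← integral_finsetSum _ fun j _ => hI j]
    refine integral_congr_ae (Eventually.of_forall fun x => ?_)
    simp only [k2r_tb_inner_eq_sum (u x), Finset.mul_sum, Finset.sum_mul]
    refine Finset.sum_congr rfl fun j _ => ?_
    ring
  have h4 : ∫ x : T3, (∑ j, a j * ⟪a, Torus.gradient (fun y => W y * u y j) x⟫_ℝ) * γ x =
      ∑ j, a j * Z' j := by
    have hI : ∀ j, Integrable (fun x : T3 => a j * (⟪a, Torus.gradient (fun y => W y * u y j) x⟫_ℝ * γ x)) :=
      fun j => (continuous_const.mul ((continuous_const.inner (hGuc j)).mul hγ)).integrable_unitAddTorus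
    simp_rw [hZ', ← integral_const_mul]
    rw [← integral_finsetSum _ fun j _ => hI j]
    refine integral_congr_ae (Eventually.of_forall fun x => ?_)
    simp only [Finset.sum_mul]
    refine Finset.sum_congr rfl fun j _ => ?_
    ring
  -- (3) assembly
  have hi1 : Integrable (fun x : T3 => W x * ⟪β x - β (τ x), a⟫_ℝ) :=
    (hWc.mul ((hβ.sub (hβ.comp hτc)).inner continuous_const)).integrable_unitAddTorus
  have hi2 : Integrable (fun x : T3 => W x * ⟪u x, a⟫_ℝ * (γ x - γ (τ x))) := by
    have h : Continuous fun x : T3 => ∑ j, a j * ((W x * u x j) * (γ x - γ (τ x))) :=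
      continuous_finsetSum _ fun j _ => continuous_const.mul ((hWuc j).mul (hγ.sub (hγ.comp hτc)))
    refine (h.integrable_unitAddTorus).congr (Eventually.of_forall fun x => ?_)
    simp only [k2r_tb_inner_eq_sum (u x), Finset.mul_sum, Finset.sum_mul]
    refine Finset.sum_congr rfl fun j _ => ?_
    ring
  have hi3 : Integrable (fun x : T3 => ⟪a, Torus.gradient W x⟫_ℝ * ⟪β x, a⟫_ℝ) :=
    ((continuous_const.inner hGc).mul (hβ.inner continuous_const)).integrable_unitAddTorus
  have hi4 : Integrable (fun x : T3 =>
      (∑ j, a j * ⟪a, Torus.gradient (fun y => W y * u y j) x⟫_ℝ) * γ x) :=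
    ((continuous_finsetSum _ fun j _ => continuous_const.mul (continuous_const.inner (hGuc j))).mul
      hγ).integrable_unitAddTorus
  have hL : (∫ x : T3, (-(W x * ⟪β x - β (τ x), a⟫_ℝ) - W x * ⟪u x, a⟫_ℝ * (γ x - γ (τ x)))) =
      -(∑ i, a i * X i) - ∑ j, a j * X' j := by
    have hi1' : Integrable (fun x : T3 => -(W x * ⟪β x - β (τ x), a⟫_ℝ)) := hi1.neg
    rw [← h1, ← h3, ← integral_neg, ← integral_sub hi1' hi2]
  have hR : (∫ x : T3, (⟪a, Torus.gradient W x⟫_ℝ * ⟪β x, a⟫_ℝ +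
      (∑ j, a j * ⟪a, Torus.gradient (fun y => W y * u y j) x⟫_ℝ) * γ x)) =
      (∑ i, a i * Z i) + ∑ j, a j * Z' j := by
    rw [integral_add hi3 hi4, h2, h4]
  rw [hL, hR]
  have hkey : -(∑ i, a i * X i) - ∑ j, a j * X' j + ε * ((∑ i, a i * Z i) + ∑ j, a j * Z' j) =
      -(∑ i, a i * (X i - ε * Z i)) - ∑ j, a j * (X' j - ε * Z' j) := by
    have e1 : ∑ i, a i * (X i - ε * Z i) = ∑ i, a i * X i - ε * ∑ i, a i * Z i := by
      rw [Finset.mul_sum, ← Finset.sum_sub_distrib]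
      refine Finset.sum_congr rfl fun i _ => ?_
      ring
    have e2 : ∑ j, a j * (X' j - ε * Z' j) = ∑ j, a j * X' j - ε * ∑ j, a j * Z' j := by
      rw [Finset.mul_sum, ← Finset.sum_sub_distrib]
      refine Finset.sum_congr rfl fun j _ => ?_
      ring
    rw [e1, e2]
    ring
  rw [hkey]
  have hai : ∀ i, |a i| ≤ 1 := fun i =>
    (by simpa using PiLp.norm_apply_le a i : |a i| ≤ ‖a‖).trans ha1
  have hb1 : |∑ i, a i * (X i - ε * Z i)| ≤ 3 * (K₂ * C * ε ^ 2) := by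
    refine (Finset.abs_sum_le_sum_abs _ _).trans ?_
    calc ∑ i, |a i * (X i - ε * Z i)| ≤ ∑ _i : Fin 3, K₂ * C * ε ^ 2 :=
          Finset.sum_le_sum fun i _ => by
            rw [abs_mul]
            have h0 : 0 ≤ K₂ * C * ε ^ 2 := (abs_nonneg _).trans (hXZ i)
            calc |a i| * |X i - ε * Z i| ≤ 1 * (K₂ * C * ε ^ 2) :=
                  mul_le_mul (hai i) (hXZ i) (abs_nonneg _) zero_le_one
              _ = K₂ * C * ε ^ 2 := one_mul _
      _ = 3 * (K₂ * C * ε ^ 2) := by simp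
  have hb2 : |∑ j, a j * (X' j - ε * Z' j)| ≤ 3 * (K₂ * C * ε ^ 2) := by
    refine (Finset.abs_sum_le_sum_abs _ _).trans ?_
    calc ∑ j, |a j * (X' j - ε * Z' j)| ≤ ∑ _j : Fin 3, K₂ * C * ε ^ 2 :=
          Finset.sum_le_sum fun j _ => by
            rw [abs_mul]
            calc |a j| * |X' j - ε * Z' j| ≤ 1 * (K₂ * C * ε ^ 2) :=
                  mul_le_mul (hai j) (hXZ' j) (abs_nonneg _) zero_le_one
              _ = K₂ * C * ε ^ 2 := one_mul _
      _ = 3 * (K₂ * C * ε ^ 2) := by simp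
  calc |-(∑ i, a i * (X i - ε * Z i)) - ∑ j, a j * (X' j - ε * Z' j)|
      ≤ |-(∑ i, a i * (X i - ε * Z i))| + |∑ j, a j * (X' j - ε * Z' j)| := abs_sub _ _
    _ ≤ 3 * (K₂ * C * ε ^ 2) + 3 * (K₂ * C * ε ^ 2) := by rw [abs_neg]; exact add_le_add hb1 hb2
    _ = 6 * K₂ * C * ε ^ 2 := by ring

/-! ## Angular averages -/

/-- `∫_{S²} (ω·a)(b·ω) dσ(ω) = (4π/3) (b·a)` (stub B3b (ii)). [cite: CIP1994, §3.1] -/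
theorem k2r_tb_sphere_avg_inner (a b : V3) :
    ∫ ω : sphere (0 : V3) 1, ⟪(ω : V3), a⟫_ℝ * ⟪b, (ω : V3)⟫_ℝ ∂sphereMeasure = 4 * Real.pi / 3 * ⟪b, a⟫_ℝ := by
  have h : ∀ ω : sphere (0 : V3) 1, ⟪(ω : V3), a⟫_ℝ * ⟪b, (ω : V3)⟫_ℝ = ⟪a, (ω : V3)⟫_ℝ * ⟪b, (ω : V3)⟫_ℝ :=
    fun ω => by rw [real_inner_comm]
  simp_rw [h]
  rw [k2r_integral_inner_mul_inner_sphereMeasure a b, real_inner_comm]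

/-- `∫_{S²} ∑ⱼ ωⱼ (ω·aⱼ) dσ(ω) = (4π/3) ∑ⱼ (aⱼ)ⱼ` (stub B3b (ii) with `ωⱼ = eⱼ·ω`). [cite: CIP1994, §3.1] -/
theorem k2r_tb_sphere_avg_sum (A : Fin 3 → V3) :
    ∫ ω : sphere (0 : V3) 1, ∑ j, (ω : V3) j * ⟪(ω : V3), A j⟫_ℝ ∂sphereMeasure =
      4 * Real.pi / 3 * ∑ j, A j j := by
  haveI := isFiniteMeasure_sphereMeasure (E := V3)
  have hI : ∀ j, Integrable (fun ω : sphere (0 : V3) 1 => (ω : V3) j * ⟪(ω : V3), A j⟫_ℝ)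
      (sphereMeasure : Measure (sphere (0 : V3) 1)) := fun j =>
    Continuous.integrable_of_hasCompactSupport (by fun_prop) (HasCompactSupport.of_compactSpace _)
  rw [integral_finsetSum _ fun j _ => hI j, Finset.mul_sum]
  refine Finset.sum_congr rfl fun j _ => ?_
  have h : ∀ ω : sphere (0 : V3) 1, (ω : V3) j * ⟪(ω : V3), A j⟫_ℝ =
      ⟪EuclideanSpace.single j (1 : ℝ), (ω : V3)⟫_ℝ * ⟪A j, (ω : V3)⟫_ℝ := fun ω => by
    rw [← k2r_tb_apply_eq_inner_single, real_inner_comm]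
  simp_rw [h]
  rw [k2r_integral_inner_mul_inner_sphereMeasure, ← k2r_tb_apply_eq_inner_single]

/-! ## Fubini and the identification with the excess-pressure work -/

/-- The integrand of `B(ω) = ∫ [(ω·∇W)(β·ω) + (∑ⱼ ωⱼ ω·∇(Wuⱼ)) γ] dx` is integrable on `S² × 𝕋³`
(continuous on a compact space, finite measure). [folklore] -/
theorem k2r_tb_integrable_b {W : T3 → ℝ} {u : T3 → V3} (hW : Torus.IsSmooth W)
    (hWu : ∀ j : Fin 3, Torus.IsSmooth (fun y => W y * u y j)) {β : T3 → V3} {γ : T3 → ℝ}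
    (hβ : Continuous β) (hγ : Continuous γ) :
    Integrable (fun p : sphere (0 : V3) 1 × T3 =>
      ⟪(p.1 : V3), Torus.gradient W p.2⟫_ℝ * ⟪β p.2, (p.1 : V3)⟫_ℝ +
        (∑ j, (p.1 : V3) j * ⟪(p.1 : V3), Torus.gradient (fun y => W y * u y j) p.2⟫_ℝ) * γ p.2)
      ((sphereMeasure : Measure (sphere (0 : V3) 1)).prod volume) := by
  have hGc : Continuous (Torus.gradient W) := hW.gradient.continuous
  have hGuc : ∀ j, Continuous (Torus.gradient (fun y => W y * u y j)) :=
    fun j => (hWu j).gradient.continuous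
  refine k2r_tb_integrable_sphere_torus ?_
  refine (((continuous_subtype_val.comp continuous_fst).inner (hGc.comp continuous_snd)).mul
    ((hβ.comp continuous_snd).inner (continuous_subtype_val.comp continuous_fst))).add
    ((continuous_finsetSum _ fun j _ => ?_).mul (hγ.comp continuous_snd))
  exact ((continuous_apply j).comp (by fun_prop : Continuous fun p : sphere (0 : V3) 1 × T3 =>
    ((p.1 : V3) : Fin 3 → ℝ))).mul
    ((continuous_subtype_val.comp continuous_fst).inner ((hGuc j).comp continuous_snd))

/-- **Angular average of the first-order term: the excess-pressure work.** For `W` smooth, `W uⱼ` smooth,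
`β, γ` continuous:
`∫_{S²} ∫_{𝕋³} [(ω·∇W)(β·ω) + (∑ⱼ ωⱼ ω·∇(Wuⱼ)) γ] dx dσ(ω) = (4π/3) ∫_{𝕋³} (β·∇W + γ div(W u)) dx`
(Fubini, `∫ ωᵢωⱼ dσ = (4π/3)δᵢⱼ`, and `div(W u) = ∑ⱼ ∂ⱼ(W uⱼ) = ∑ⱼ (∇(W uⱼ))ⱼ`). [cite: CIP1994, §3.1] -/
theorem k2r_tb_angular {W : T3 → ℝ} {u : T3 → V3} (hW : Torus.IsSmooth W)
    (hWu : ∀ j : Fin 3, Torus.IsSmooth (fun y => W y * u y j)) {β : T3 → V3} {γ : T3 → ℝ}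
    (hβ : Continuous β) (hγ : Continuous γ) :
    ∫ ω : sphere (0 : V3) 1, (∫ x : T3, (⟪(ω : V3), Torus.gradient W x⟫_ℝ * ⟪β x, (ω : V3)⟫_ℝ +
        (∑ j, (ω : V3) j * ⟪(ω : V3), Torus.gradient (fun y => W y * u y j) x⟫_ℝ) * γ x)) ∂sphereMeasure =
      4 * Real.pi / 3 * ∫ x : T3, (⟪β x, Torus.gradient W x⟫_ℝ +
        γ x * Torus.divergence (fun y => W y • u y) x) := by
  haveI := isFiniteMeasure_sphereMeasure (E := V3)
  have hswap := integral_integral_swap (μ := (sphereMeasure : Measure (sphere (0 : V3) 1)))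
    (ν := (volume : Measure T3)) (f := fun (ω : sphere (0 : V3) 1) (x : T3) =>
      ⟪(ω : V3), Torus.gradient W x⟫_ℝ * ⟪β x, (ω : V3)⟫_ℝ +
        (∑ j, (ω : V3) j * ⟪(ω : V3), Torus.gradient (fun y => W y * u y j) x⟫_ℝ) * γ x)
    (k2r_tb_integrable_b hW hWu hβ hγ)
  rw [hswap, ← integral_const_mul]
  refine integral_congr_ae (Eventually.of_forall fun x => ?_)
  have hI1 : Integrable (fun ω : sphere (0 : V3) 1 => ⟪(ω : V3), Torus.gradient W x⟫_ℝ * ⟪β x, (ω : V3)⟫_ℝ)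
      (sphereMeasure : Measure (sphere (0 : V3) 1)) :=
    Continuous.integrable_of_hasCompactSupport (by fun_prop) (HasCompactSupport.of_compactSpace _)
  have hI2 : Integrable (fun ω : sphere (0 : V3) 1 =>
      (∑ j, (ω : V3) j * ⟪(ω : V3), Torus.gradient (fun y => W y * u y j) x⟫_ℝ) * γ x)
      (sphereMeasure : Measure (sphere (0 : V3) 1)) :=
    Continuous.integrable_of_hasCompactSupport (by fun_prop) (HasCompactSupport.of_compactSpace _)
  simp only
  rw [integral_add hI1 hI2, k2r_tb_sphere_avg_inner, integral_mul_const, k2r_tb_sphere_avg_sum]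
  have hdiv : ∑ j, Torus.gradient (fun y => W y * u y j) x j = Torus.divergence (fun y => W y • u y) x := by
    rw [k2r_divergence_smul]
    exact Finset.sum_congr rfl fun j _ => k2r_tb_gradient_apply ((hWu j).isContDiff (by simp)) x j
  rw [hdiv]
  ring

/-- **Registered sub-goal `stub_transferBound_angular`** (K2R line `birth`, stub G3b, helper III): the
angular average of the first-order term equals `(4π/3)` times the excess-pressure work integrand
(`k2r_tb_angular`), as a closed statement. [cite: CIP1994, §3.1] -/
theorem stub_transferBound_angular :
    ∀ (W : UnitAddTorus (Fin 3) → ℝ) (u : UnitAddTorus (Fin 3) → EuclideanSpace ℝ (Fin 3)),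
    Literature.Analysis.FunctionSpaces.Torus.IsSmooth W → (∀ j : Fin 3,
    Literature.Analysis.FunctionSpaces.Torus.IsSmooth (fun y => W y * u y j)) → ∀ (β : UnitAddTorus (Fin 3) →
    EuclideanSpace ℝ (Fin 3)) (γ : UnitAddTorus (Fin 3) → ℝ), Continuous β → Continuous γ → ∫ ω :
    Metric.sphere (0 : EuclideanSpace ℝ (Fin 3)) 1, (∫ x : UnitAddTorus (Fin 3), (inner ℝ (ω : EuclideanSpace
    ℝ (Fin 3)) (Literature.Analysis.FunctionSpaces.Torus.gradient W x) * inner ℝ (β x) (ω : EuclideanSpace ℝ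
    (Fin 3)) + (∑ j, (ω : EuclideanSpace ℝ (Fin 3)) j * inner ℝ (ω : EuclideanSpace ℝ (Fin 3))
    (Literature.Analysis.FunctionSpaces.Torus.gradient (fun y => W y * u y j) x)) * γ x))
    ∂Literature.MathematicalPhysics.KineticTheory.sphereMeasure = 4 * Real.pi / 3 * ∫ x : UnitAddTorus (Fin
    3), (inner ℝ (β x) (Literature.Analysis.FunctionSpaces.Torus.gradient W x) + γ x *
    Literature.Analysis.FunctionSpaces.Torus.divergence (fun y => W y • u y) x) :=
  fun _ _ hW hWu _ _ hβ hγ => k2r_tb_angular hW hWu hβ hγ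

end Summit.AtomisticToContinuum.HydrodynamicLimit.Theorems.EnskogAdjointDuality

end
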